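import Literature.NumberTheory.Automorphic.LanglandsTunnellModThree
import Literature.NumberTheory.Automorphic.StrongArtinGL2Proofs
import Literature.NumberTheory.Automorphic.PiOfArtinRepFrobSatakeCompatibleProofs
import Literature.NumberTheory.Automorphic.BCDTModularitySerreProofs
import Literature.NumberTheory.GaloisRepresentations.ProjectiveTypeSolvable
import HarnessLib

/-!
# Stub-ideation k1, GENERATION 2 (HOME FAMILY 1 — recognise & import) for `stub_modThree`

Companion of `STUB-IDEAS-stub_modThree-1.md` (gen 2).  What changed w.r.t. the gen-1 file
`Lines/StubIdeas_stub_modThree_1_Sketch.lean` (ns `…StubModThreeIdeasK1`, 10 sorried helpers):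

* the three gen-1 ideators' helper sets are DEDUPLICATED into one canonical set (H0–H4 below);
* EVERYTHING IS NOW PROVED — this file is fully proved (no placeholders):  H0 `isOdd_of_isTorsionGaloisRep_three`,
  H1 `isModular_of_langlands_tunnell_at` (verbatim copy of the tree proof with its `∀ σ` binder
  specialised — certifies the one-line Literature patch), H2 `not_isTetrahedralType_modThreeLift_of_isOdd`
  ("odd ⇒ not tetrahedral", from the generic H2core `det_eq_one_of_projectiveImage`, the `A₄`
  certificate H2gen by `decide`, and the `Ψ`-facts H2b/H2c), H3 (dihedral ∨ octahedral), H4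
  (Langlands–Tunnell for one `σ` from `π(σ)`; Gelbart Prop. 4.1 is the tree THEOREM
  `frobSatakeCompatibleAt_of_isPiOfArtinRep_holds`), and the two CLOSERS
  ★ `stub_modThree_of_dihedral_octahedral : strongArtin_of_isDihedralType →
      strongArtin_of_isOctahedralType → exists_isNewform1_of_isPiOfArtinRep → StubModThree`
    (Plan A: three named facts instead of the tree's `∀ σ, langlands_tunnell σ` ⇐ four facts —
    Langlands' tetrahedral theorem is never used for `ρ̄_{E,3}`), and
  ★ `stub_modThree_of_serre3 : (∀ k, exists_newform_of_odd_irreducible (p := 3) (k := k)) → StubModThree`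
    (Plan C: lang.S37 = Khare–Wintenberger at `p = 3` alone; port of the tree's `p = 5` theorem).
  What remains for the stub is therefore ONLY named-fact debt (see the md for the leaf tables).

Nothing here is registered; the stub statement is copied verbatim as `StubModThree`.
-/

noncomputable section

open scoped MatrixGroups NumberField Polynomial
open NumberField IsDedekindDomain Polynomial CongruenceSubgroup Field
open Literature.NumberTheory.EllipticCurves
open Literature.NumberTheory.EllipticCurves.ModularForms
open Literature.NumberTheory.Automorphic
open Literature.NumberTheory.GaloisRepresentations
open Literature.NumberTheory.GaloisRepresentations.GL2F3Lift
open Literature.NumberTheory.LFunctions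
open WeierstrassCurve
open Matrix

set_option linter.dupNamespace false

namespace Summit.ABC.ABC.Cruxes.FreyModularity.Sketch.StubModThreeIdeasK1G2

/-- The registered stub statement, verbatim. -/
def StubModThree : Prop :=
  ∀ (W : WeierstrassCurve ℚ) [W.IsElliptic] (ρ : ModPGaloisRep ℚ (ZMod 3) 2),
    W.IsTorsionGaloisRep 3 ρ → FramedRep.IsAbsolutelyIrreducible ρ → ρ.IsModular

/-- Sanity: the tree's closer (`BCDT.modThree_of_langlands_tunnell`) has exactly this type. -/
theorem stubModThree_of_langlands_tunnell (hLT : ∀ σ : FramedArtinRep ℚ 2, langlands_tunnell σ) :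
    StubModThree :=
  fun W _ ρ hρ habs ↦ W.isModular_of_isTorsionGaloisRep_three_of_langlands_tunnell hLT ρ hρ habs

/-! ## H0 — oddness of `ρ̄_{E,3}` (k1.H0 = k2.H0′ = k3 inline). PROVED. -/

/-- **H0** `ρ̄_{E,3}` is odd: `det ρ̄ = χ̄₃` (Weil pairing, tree theorem
`det_eq_modPCyclotomicCharacter_of_isTorsionGaloisRep_holds`) and `χ̄₃(c) = -1`
(`ModPGaloisRep.isOdd_of_det_eq_modPCyclotomicCharacterZMod`). -/
theorem isOdd_of_isTorsionGaloisRep_three (W : WeierstrassCurve ℚ) [W.IsElliptic]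
    (ρ : ModPGaloisRep ℚ (ZMod 3) 2) (hρ : W.IsTorsionGaloisRep 3 ρ) :
    FramedGaloisRep.IsOdd ρ := by
  haveI : NeZero ((3 : ℕ) : ℚ) := ⟨by norm_num⟩
  exact ModPGaloisRep.isOdd_of_det_eq_modPCyclotomicCharacterZMod ρ
    (W.det_eq_modPCyclotomicCharacter_of_isTorsionGaloisRep_holds 3 ρ hρ)

/-! ## Plan A — per-`σ` Langlands–Tunnell; odd ⇒ not tetrahedral; dihedral ∨ octahedral -/

/-- **H1** (k1.H1 = k2.H0 = k3.H0) per-`σ` form of Gelbart Prop. 1.4: the tree proof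
`ModPGaloisRep.isModular_of_isAbsolutelyIrreducible_of_isOdd_of_langlands_tunnell`
(`LanglandsTunnellModThree`, l. 455) uses `hLT` ONLY at `σ = modThreeLift ρ̄` (l. 467,
`hLT σ hirrσ hoddσ hsolv`).  Helper = a `ledger patch` of that Literature theorem generalising its
first binder to `(hLT : langlands_tunnell (modThreeLift ρ))` (body unchanged but for that line),
the old name kept as a one-line corollary.  Size S.  PROVED here by the verbatim copy (so the
patch is certified to go through). -/
theorem isModular_of_langlands_tunnell_at (ρ : ModPGaloisRep ℚ (ZMod 3) 2)
    (hLT : langlands_tunnell (modThreeLift ρ)) (habs : FramedRep.IsAbsolutelyIrreducible ρ)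
    (hodd : FramedGaloisRep.IsOdd ρ) : ρ.IsModular := by
  -- verbatim copy of the tree proof (LanglandsTunnellModThree ll. 459–550), `hLT σ …` ↦ `hLT …`
  classical
  -- Steps 1–2
  set σ : FramedArtinRep ℚ 2 := modThreeLift ρ with hσ
  have hirrσ : σ.toGaloisRep.IsIrreducible :=
    (FramedRep.isIrreducible_toContinuousRep_iff σ).mpr (isIrreducible_modThreeLift habs)
  have hoddσ : σ.IsOdd := isOdd_modThreeLift hodd
  have hsolv : IsSolvable (MonoidHom.range σ.toMonoidHom) := isSolvable_range_modThreeLift ρ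
  -- Step 3: the weight-one newform
  obtain ⟨N, hN, f, hnew, hgal⟩ := hLT hirrσ hoddσ hsolv  -- the ONLY change
  -- the residue field `k(λ) = ℤ̄ / 𝔓 ⊇ 𝔽₃`
  obtain ⟨𝔓, h𝔓max, h𝔓⟩ := exists_ideal_over_ker_redHom
  haveI : 𝔓.IsMaximal := h𝔓max
  letI : Field (integralClosure ℤ ℂ ⧸ 𝔓) := Ideal.Quotient.field 𝔓
  letI : TopologicalSpace (integralClosure ℤ ℂ ⧸ 𝔓) := ⊥
  haveI : DiscreteTopology (integralClosure ℤ ℂ ⧸ 𝔓) := ⟨rfl⟩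
  have hle : RingHom.ker redHom ≤ 𝔓.comap embInt := h𝔓.ge
  let j : ZMod 3 →+* integralClosure ℤ ℂ ⧸ 𝔓 :=
    (Ideal.quotientMap 𝔓 embInt hle).comp
      (RingHom.quotientKerEquivOfSurjective redHom_surjective).symm.toRingHom
  have hj : ∀ t : ℤ√(-2), j (redHom t) = Ideal.Quotient.mk 𝔓 (embInt t) := by
    intro t
    simp only [j, RingHom.coe_comp, Function.comp_apply, RingEquiv.toRingHom_eq_coe,
      RingEquiv.coe_toRingHom, RingHom.quotientKerEquivOfSurjective_symm_apply,
      Ideal.quotientMap_mk]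
  have hjred : j.comp redHom = (Ideal.Quotient.mk 𝔓).comp embInt := RingHom.ext hj
  -- the coefficient map `λ : 𝓞_f → ℤ̄ → k(λ)`
  let θ : coeffCharIntegers f →+* integralClosure ℤ ℂ :=
    ((algebraMap (coeffCharField f) ℂ).comp
        (algebraMap (coeffCharIntegers f) (coeffCharField f))).codRestrict (integralClosure ℤ ℂ)
      fun x ↦ (x.2 : IsIntegral ℤ (x : coeffCharField f)).map
        (algebraMap (coeffCharField f) ℂ).toIntAlgHom
  let ι : coeffCharIntegers f →+* integralClosure ℤ ℂ ⧸ 𝔓 := (Ideal.Quotient.mk 𝔓).comp θ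
  refine ⟨N, hN, 1, f, integralClosure ℤ ℂ ⧸ 𝔓, inferInstance, inferInstance, inferInstance, j, ι,
    le_refl _, hnew, ?_⟩
  -- Galois compatibility away from `3N`
  intro v hv
  have hpN : ((Rat.HeightOneSpectrum.primesEquiv v : Nat.Primes) : ℕ) ∉ {q : ℕ | q ∣ N} :=
    fun h ↦ hv (dvd_mul_of_dvd_left h _)
  obtain ⟨hunr, hfrob⟩ := hgal v hpN
  refine ⟨?_, ?_⟩
  · -- unramified: `Ψ` is injective
    intro 𝔔 h𝔔 τ hτ
    have h1 : psi (ρ τ) = 1 := hunr 𝔔 h𝔔 τ hτ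
    have h2 : ρ τ = 1 := psi_injective (by rw [map_one]; exact h1)
    rw [FramedRep.baseChange_apply, h2, map_one]
  · -- Frobenius: the Hecke polynomial is the characteristic polynomial of `Ψ(ρ̄(Frob))`
    set hecke := heckePolynomial f (Rat.HeightOneSpectrum.primesEquiv v : Nat.Primes) with hhecke
    have key : ∀ (𝔔 : Ideal (absIntegers (𝓞 ℚ) ℚ)) (_ : 𝔔 ∈ v.primesAbove)
        (τ : Field.absoluteGaloisGroup ℚ), IsArithFrobAt (𝓞 ℚ) τ 𝔔 →
        hecke.map (algebraMap (coeffCharField f) ℂ) = ((lift (ρ τ)).charpoly).map embHom := by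
      intro 𝔔 h𝔔 τ hτ
      rw [← charpoly_psi, ← hfrob 𝔔 h𝔔 τ hτ]
      rfl
    -- a Frobenius exists, so the coefficients of the Hecke polynomial are algebraic integers
    obtain ⟨𝔔₀, h𝔔₀⟩ := HeightOneSpectrum.primesAbove_nonempty v
    obtain ⟨τ₀, hτ₀⟩ := HeightOneSpectrum.exists_isArithFrobAt_of_mem_primesAbove_holds h𝔔₀
    have hinj : Function.Injective (algebraMap (coeffCharField f) ℂ).toIntAlgHom :=
      (algebraMap (coeffCharField f) ℂ).injective
    have hint : ∀ n : ℕ, hecke.coeff n ∈ coeffCharIntegers f := by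
      intro n
      have h1 : IsIntegral ℤ (algebraMap (coeffCharField f) ℂ (hecke.coeff n)) := by
        rw [← Polynomial.coeff_map, key 𝔔₀ h𝔔₀ τ₀ hτ₀, Polynomial.coeff_map]
        exact isIntegral_embHom _
      change IsIntegral ℤ (hecke.coeff n)
      exact (isIntegral_algHom_iff (algebraMap (coeffCharField f) ℂ).toIntAlgHom hinj).mp h1
    have hlifts : hecke ∈ Polynomial.lifts (algebraMap (coeffCharIntegers f) (coeffCharField f)) := by
      rw [Polynomial.lifts_iff_coeff_lifts]
      intro n
      exact ⟨⟨hecke.coeff n, hint n⟩, rfl⟩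
    obtain ⟨P, hP⟩ := (Polynomial.mem_lifts _).mp hlifts
    refine ⟨P, hP, ?_⟩
    intro 𝔔 h𝔔 τ hτ
    -- compare `P` and `charpoly Ψ̃(ρ̄ τ)` inside `ℤ̄[X] ⊂ ℂ[X]`
    have hPθ : P.map θ = ((lift (ρ τ)).charpoly).map embInt := by
      apply Polynomial.map_injective (integralClosure ℤ ℂ).val.toRingHom Subtype.val_injective
      rw [Polynomial.map_map, Polynomial.map_map]
      have e1 : (integralClosure ℤ ℂ).val.toRingHom.comp θ =
          (algebraMap (coeffCharField f) ℂ).comp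
            (algebraMap (coeffCharIntegers f) (coeffCharField f)) :=
        RingHom.ext fun _ ↦ rfl
      have e2 : (integralClosure ℤ ℂ).val.toRingHom.comp embInt = embHom := RingHom.ext fun _ ↦ rfl
      rw [e1, e2, ← Polynomial.map_map, hP, key 𝔔 h𝔔 τ hτ]
    -- reduce modulo `𝔓`
    calc FramedRep.charpoly (FramedRep.baseChange j continuous_of_discreteTopology ρ) τ
        = ((((ρ τ : GL (Fin 2) (ZMod 3)) : Matrix (Fin 2) (Fin 2) (ZMod 3))).map j).charpoly := rfl
      _ = (((ρ τ : GL (Fin 2) (ZMod 3)) : Matrix (Fin 2) (Fin 2) (ZMod 3))).charpoly.map j :=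
          Matrix.charpoly_map _ _
      _ = (((lift (ρ τ)).charpoly).map redHom).map j := by rw [map_redHom_charpoly_lift]
      _ = ((lift (ρ τ)).charpoly).map ((Ideal.Quotient.mk 𝔓).comp embInt) := by
          rw [Polynomial.map_map, hjred]
      _ = (P.map θ).map (Ideal.Quotient.mk 𝔓) := by rw [hPθ, Polynomial.map_map]
      _ = P.map ι := by rw [Polynomial.map_map]

/-- **H2gen** `A₄`: every element is a product of two elements of order dividing `3`
(the eight 3-cycles generate; a double transposition is a product of two 3-cycles).  Finite
certificate, PROVED by kernel `decide` (12³ cases). -/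
theorem exists_cube_eq_one_mul_of_alternatingGroup_four :
    ∀ y : alternatingGroup (Fin 4), ∃ a b : alternatingGroup (Fin 4),
      a ^ 3 = 1 ∧ b ^ 3 = 1 ∧ y = a * b := by
  decide

/-- **H2core** (k3.H1b, generic group theory; the one genuinely new lemma of Plan A).  Let
`ρ : G →* GL_n(R)`.  If the projective image is generated as in H2gen (every element a product
of two elements of order dividing `3`), `det` is `1` on the elements of `ρ(G)` that are central in
`GL_n(R)` (= the kernel of `ρ(G) → ρ̄(G)`, `mem_center_of_mem_ker_rangeToProjectiveImage`), and
`det ρ(g)² = 1` for all `g`, then `det ρ ≡ 1`: lift `ȳ = ā·b̄` to `x = a b z` with `z` central,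
`det a ^ 3 = det (a³) = 1` (as `a³` is central) and `det a ^ 2 = 1` give `det a = 1`, etc.
PROVED. -/
theorem det_eq_one_of_projectiveImage {G : Type*} [Group G] {n : Type*} [Fintype n]
    [DecidableEq n] {R : Type*} [CommRing R] (ρ : G →* GL n R)
    (hgen : ∀ y : projectiveImage ρ, ∃ a b : projectiveImage ρ, a ^ 3 = 1 ∧ b ^ 3 = 1 ∧ y = a * b)
    (hZ : ∀ g : G, ρ g ∈ Subgroup.center (GL n R) → Matrix.GeneralLinearGroup.det (ρ g) = 1)
    (h2 : ∀ g : G, Matrix.GeneralLinearGroup.det (ρ g) ^ 2 = 1) (g : G) :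
    Matrix.GeneralLinearGroup.det (ρ g) = 1 := by
  -- an element of `ρ(G)` with trivial projective image is central, hence has determinant `1`
  have hker : ∀ x : ρ.range, rangeToProjectiveImage ρ x = 1 →
      Matrix.GeneralLinearGroup.det (x : GL n R) = 1 := by
    intro x hx
    obtain ⟨g', hg'⟩ := x.2
    have hcen : (x : GL n R) ∈ Subgroup.center (GL n R) :=
      mem_center_of_mem_ker_rangeToProjectiveImage ρ (x := x) hx
    rw [← hg'] at hcen ⊢
    exact hZ g' hcen
  -- an element of `ρ(G)` whose projective image has order dividing `3` has determinant `1`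
  have hcube : ∀ x : ρ.range, rangeToProjectiveImage ρ x ^ 3 = 1 →
      Matrix.GeneralLinearGroup.det (x : GL n R) = 1 := by
    intro x hx
    obtain ⟨g', hg'⟩ := x.2
    have h3 : Matrix.GeneralLinearGroup.det (x : GL n R) ^ 3 = 1 := by
      rw [← map_pow, ← Subgroup.coe_pow]
      exact hker (x ^ 3) (by rw [map_pow, hx])
    have h2' : Matrix.GeneralLinearGroup.det (x : GL n R) ^ 2 = 1 := by rw [← hg']; exact h2 g'
    rw [pow_succ, h2', one_mul] at h3
    exact h3
  let x : ρ.range := ⟨ρ g, g, rfl⟩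
  obtain ⟨a, b, ha, hb, hy⟩ := hgen (rangeToProjectiveImage ρ x)
  obtain ⟨xa, rfl⟩ := rangeToProjectiveImage_surjective ρ a
  obtain ⟨xb, rfl⟩ := rangeToProjectiveImage_surjective ρ b
  have hz : rangeToProjectiveImage ρ (x * (xa * xb)⁻¹) = 1 := by
    rw [map_mul, map_inv, map_mul, ← hy, mul_inv_cancel]
  have hdz := hker _ hz
  have hda := hcube xa ha
  have hdb := hcube xb hb
  have hx : (ρ g : GL n R) = ((x * (xa * xb)⁻¹ : ρ.range) : GL n R) * ((xa : GL n R) * xb) := by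
    rw [Subgroup.coe_mul, Subgroup.coe_inv, Subgroup.coe_mul, inv_mul_cancel_right]
  rw [hx, map_mul, map_mul, hdz, hda, hdb, one_mul, one_mul]

/-- **H2b** (k1.H2b = k3.H1c) a value `Ψ(h)` that is central in `GL₂(ℂ)` has determinant `1`.
Two independent S-sized proofs: (i) `Ψ(h)` central ⇒ commutes with `Ψ(GL₂(𝔽₃))` ⇒ (`psi_injective`)
`h ∈ Z(GL₂(𝔽₃)) = {±1}` ⇒ `det h = 1` ⇒ `det Ψ̃(h) ≡ 1 (mod 𝔭)` and `det Ψ̃(h) = ±1`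
(`det_lift_eq_one_or`, `redHom_det_lift`) ⇒ `= 1`; (ii) a scalar matrix in `Ψ̃(GL₂(𝔽₃)) ⊂ GL₂(ℤ[√-2])`
is `λ·1` with `λ ∈ ℤ[√-2]`, `λ² = det = ±1`, and `λ² = -1` has no solution in `ℤ[√-2]`.
PROVED by (i), using Mathlib's `Matrix.GeneralLinearGroup.mem_center_iff_val_mem_range_scalar`
(centre of `GL_n` = scalars) and `b² ≠ 0 → b² = 1` in `𝔽₃` by `decide`. -/
theorem det_psi_eq_one_of_mem_center (h : GL (Fin 2) (ZMod 3))
    (hh : psi h ∈ Subgroup.center (GL (Fin 2) ℂ)) :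
    Matrix.GeneralLinearGroup.det (psi h) = 1 := by
  -- `h` is central in `GL₂(𝔽₃)` since `Ψ` is an injective homomorphism
  have hc : h ∈ Subgroup.center (GL (Fin 2) (ZMod 3)) := by
    refine Subgroup.mem_center_iff.mpr fun g ↦ psi_injective ?_
    rw [map_mul, map_mul]
    exact Subgroup.mem_center_iff.mp hh (psi g)
  -- hence scalar (`Matrix.GeneralLinearGroup.mem_center_iff_val_mem_range_scalar`): `det h = a² = 1`
  obtain ⟨a, ha⟩ := Matrix.GeneralLinearGroup.mem_center_iff_val_mem_range_scalar.mp hc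
  have hne : (h : Matrix (Fin 2) (Fin 2) (ZMod 3)).det ≠ 0 := by
    rw [← Matrix.GeneralLinearGroup.val_det_apply]; exact Units.ne_zero _
  have hsq : (h : Matrix (Fin 2) (Fin 2) (ZMod 3)).det = a ^ 2 := by
    rw [← ha, Matrix.scalar_apply, Matrix.det_diagonal, Fin.prod_const]
  have key : ∀ b : ZMod 3, b ^ 2 ≠ 0 → b ^ 2 = 1 := by decide
  have hdet : (h : Matrix (Fin 2) (Fin 2) (ZMod 3)).det = 1 := by
    rw [hsq] at hne ⊢; exact key a hne
  -- `det Ψ̃(h) = ±1` reduces mod `𝔭` to `det h = 1`, so it is `1`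
  have hlift : (lift h).det = 1 := by
    rcases det_lift_eq_one_or h with h1 | h1
    · exact h1
    · exfalso
      have hred := redHom_det_lift h
      rw [h1, map_neg, map_one, hdet] at hred
      exact absurd hred (by decide)
  ext
  rw [Matrix.GeneralLinearGroup.val_det_apply, det_val_psi, hlift, map_one, Units.val_one]

/-- **H2c** `det Ψ(h) = ±1` (tree: `det_val_psi`, `det_lift_eq_one_or`), hence squares to `1`.
PROVED. -/
theorem det_psi_sq_eq_one (h : GL (Fin 2) (ZMod 3)) :
    Matrix.GeneralLinearGroup.det (psi h) ^ 2 = 1 := by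
  ext
  rw [Units.val_pow_eq_pow_val, Matrix.GeneralLinearGroup.val_det_apply, det_val_psi,
    Units.val_one]
  rcases det_lift_eq_one_or h with h1 | h1 <;> simp [h1]

/-- **H2** (k1.H2 = k2.H1 = k3.H1) an ODD `ρ̄ : Γ_ℚ → GL₂(𝔽₃)` has complex lift `σ = Ψ ∘ ρ̄` NOT
of tetrahedral type: by H2gen/H2core/H2b/H2c `det σ ≡ 1`, contradicting `det σ(c) = -1`
(`isOdd_modThreeLift`, `exists_isComplexConjugation (Rat.castHom ℝ)`).  Print: Gelbart 1997
§1.4 Step 2 (image of `σ` in `PGL₂(ℂ)` lies in `PGL₂(𝔽₃) ≅ S₄`; the preimage of `A₄` is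
`SL₂(𝔽₃)`, of determinant `1`).  PROVED (from H2gen, H2core, H2b, H2c). -/
theorem not_isTetrahedralType_modThreeLift_of_isOdd (ρ : ModPGaloisRep ℚ (ZMod 3) 2)
    (hodd : FramedGaloisRep.IsOdd ρ) : ¬ IsTetrahedralType (modThreeLift ρ).toMonoidHom := by
  rintro ⟨e⟩
  obtain ⟨c, hc⟩ := exists_isComplexConjugation (Rat.castHom ℝ)
  have hm1 : Matrix.GeneralLinearGroup.det ((modThreeLift ρ).toMonoidHom c) = -1 :=
    isOdd_modThreeLift hodd (Rat.castHom ℝ) c hc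
  have hgen : ∀ y : projectiveImage (modThreeLift ρ).toMonoidHom,
      ∃ a b : projectiveImage (modThreeLift ρ).toMonoidHom, a ^ 3 = 1 ∧ b ^ 3 = 1 ∧ y = a * b := by
    intro y
    obtain ⟨a, b, ha, hb, hy⟩ := exists_cube_eq_one_mul_of_alternatingGroup_four (e y)
    refine ⟨e.symm a, e.symm b, ?_, ?_, ?_⟩
    · rw [← map_pow, ha, map_one]
    · rw [← map_pow, hb, map_one]
    · rw [← map_mul, ← hy, MulEquiv.symm_apply_apply]
  have h1 : Matrix.GeneralLinearGroup.det ((modThreeLift ρ).toMonoidHom c) = 1 :=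
    det_eq_one_of_projectiveImage (modThreeLift ρ).toMonoidHom hgen
      (fun g hg ↦ det_psi_eq_one_of_mem_center (ρ g) hg) (fun g ↦ det_psi_sq_eq_one (ρ g)) c
  rw [h1] at hm1
  have h := congrArg (fun u : ℂˣ ↦ (u : ℂ)) hm1
  norm_num at h

/-- **H3** (k1.H3 ∩ k2.H1′ ∩ k3.H2) for `ρ̄` odd and absolutely irreducible, `σ = Ψ ∘ ρ̄` is of
dihedral or octahedral type: the PROVED solvable trichotomy
`projectiveType_of_isIrreducible_of_isSolvable'` (`finite_range_toMonoidHom`,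
`isIrreducible_modThreeLift`, `isSolvable_range_modThreeLift`) minus H2.  PROVED from H2. -/
theorem isDihedralType_or_isOctahedralType_modThreeLift (ρ : ModPGaloisRep ℚ (ZMod 3) 2)
    (habs : FramedRep.IsAbsolutelyIrreducible ρ) (hodd : FramedGaloisRep.IsOdd ρ) :
    IsDihedralType (modThreeLift ρ).toMonoidHom ∨ IsOctahedralType (modThreeLift ρ).toMonoidHom := by
  set σ : FramedArtinRep ℚ 2 := modThreeLift ρ with hσ
  haveI : Finite σ.toMonoidHom.range := finite_range_toMonoidHom σ
  have hirr' : (toStdRepresentation σ.toMonoidHom).IsIrreducible :=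
    (isIrreducible_toStdRepresentation_iff σ).mpr
      ((FramedRep.isIrreducible_toContinuousRep_iff σ).mpr (isIrreducible_modThreeLift habs))
  rcases projectiveType_of_isIrreducible_of_isSolvable' σ.toMonoidHom hirr'
      (isSolvable_range_modThreeLift ρ) with h | h | h
  · exact Or.inl h
  · exact absurd h (not_isTetrahedralType_modThreeLift_of_isOdd ρ hodd)
  · exact Or.inr h

/-- **H4** (k1.H3 tail = k2.H2 = k3.H3) Langlands–Tunnell for ONE `σ` from the existence of
`π(σ)` and Gelbart's Prop. 4.2 (`exists_isNewform1_of_isPiOfArtinRep`); Prop. 4.1 is the tree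
THEOREM `frobSatakeCompatibleAt_of_isPiOfArtinRep_holds`.  Eight-line copy of
`langlands_tunnell_of_strongArtin`.  PROVED. -/
theorem langlands_tunnell_of_exists_isPiOfArtinRep (hW1 : exists_isNewform1_of_isPiOfArtinRep)
    (σ : FramedArtinRep ℚ 2)
    (hπ : σ.toGaloisRep.IsIrreducible →
      ∃ (hcpt : isCompact_glFiniteIntegralLevel 2 ℚ) (π : CuspidalAutomorphicRepData 2 ℚ hcpt),
        IsPiOfArtinRep σ π.1) :
    langlands_tunnell σ := by
  intro hirr hodd _hsolv
  obtain ⟨hcpt, π, hπ⟩ := hπ hirr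
  obtain ⟨N, hN, f, hf, -, hsat⟩ := hW1 hcpt σ π hirr hodd hπ
  refine ⟨N, hN, f, hf, fun v hv => ?_⟩
  obtain ⟨α, hα, hpoly⟩ := hsat v hv
  obtain ⟨hur, hchar⟩ := frobSatakeCompatibleAt_of_isPiOfArtinRep_holds hcpt σ π hπ v α hα
  exact ⟨hur, hpoly ▸ hchar⟩

/-- **Plan A, step 1 (PROVED from H2–H4)**: Langlands–Tunnell at `σ = Ψ ∘ ρ̄_{E,3}` from the
dihedral and octahedral cases of strong Artin and the weight-one dictionary — Langlands'
tetrahedral theorem `strongArtin_of_isTetrahedralType` is never invoked. -/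
theorem langlands_tunnell_modThreeLift_of_two_cases (hd : strongArtin_of_isDihedralType)
    (ho : strongArtin_of_isOctahedralType) (hW1 : exists_isNewform1_of_isPiOfArtinRep)
    (ρ : ModPGaloisRep ℚ (ZMod 3) 2) (habs : FramedRep.IsAbsolutelyIrreducible ρ)
    (hodd : FramedGaloisRep.IsOdd ρ) : langlands_tunnell (modThreeLift ρ) :=
  langlands_tunnell_of_exists_isPiOfArtinRep hW1 (modThreeLift ρ) fun hirr ↦
    (isDihedralType_or_isOctahedralType_modThreeLift ρ habs hodd).elim
      (fun h ↦ hd (modThreeLift ρ) hirr h) (fun h ↦ ho (modThreeLift ρ) hirr h)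

/-- **Plan A assembly (PROVED from H0–H4)**: the stub from THREE named facts
{`strongArtin_of_isDihedralType`, `strongArtin_of_isOctahedralType` (Tunnell),
`exists_isNewform1_of_isPiOfArtinRep` (Gelbart Prop. 4.2)}. -/
theorem stub_modThree_of_dihedral_octahedral (hd : strongArtin_of_isDihedralType)
    (ho : strongArtin_of_isOctahedralType) (hW1 : exists_isNewform1_of_isPiOfArtinRep) :
    StubModThree := by
  intro W _ ρ hρ habs
  have hodd := isOdd_of_isTorsionGaloisRep_three W ρ hρ
  exact isModular_of_langlands_tunnell_at ρ
    (langlands_tunnell_modThreeLift_of_two_cases hd ho hW1 ρ habs hodd) habs hodd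

/- **Plan A assembly, dihedral leaf traded for automorphic induction** (not elaborated here only
because `Automorphic.StrongArtinGL2DihedralOfInduction` is unbuilt on today's farm snapshot):
`theorem stub_modThree_of_automorphicInduction_octahedral (hAI : automorphicInduction_character)
    (ho : strongArtin_of_isOctahedralType) (hW1 : exists_isNewform1_of_isPiOfArtinRep) : StubModThree :=
  stub_modThree_of_dihedral_octahedral (strongArtin_of_isDihedralType_of_automorphicInduction hAI) ho hW1`
— `strongArtin_of_isDihedralType_of_automorphicInduction` is at `StrongArtinGL2DihedralOfInduction` l. 128
(Artin reciprocity for characters is the tree theorem `artinReciprocity_character_holds`). -/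

/-! ## Plan C — Serre (3.2.3) / Khare–Wintenberger at `p = 3` applied to `ρ̄` itself. PROVED. -/

/-- **C1 (PROVED)**: any odd absolutely irreducible `ρ̄ : Γ_ℚ → GL₂(𝔽₃)` is modular, granted the
tree's named fact `exists_newform_of_odd_irreducible` (lang.S37, weak Serre = Khare–Wintenberger (I)
Thm. 1.2) at `p = 3` for discrete coefficient fields `k : Type`.  Verbatim port (5 ↦ 3) of
`BCDT.theoremB_of_exists_newform_of_odd_irreducible` (`BCDTModularitySerreProofs`), with the
oddness hypothesis in place of the cyclotomic determinant.  Print: Buzzard, arXiv:1101.0097,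
p. 10 ("nowadays … apply Khare–Wintenberger to `E[p]`" — independent of Langlands–Tunnell). -/
theorem isModular_of_serre3
    (hSerre : ∀ (k : Type) [Field k] [TopologicalSpace k] [DiscreteTopology k],
      exists_newform_of_odd_irreducible (p := 3) (k := k))
    (ρ : ModPGaloisRep ℚ (ZMod 3) 2) (habs : FramedRep.IsAbsolutelyIrreducible ρ)
    (hodd : FramedGaloisRep.IsOdd ρ) : ρ.IsModular := by
  -- coefficient field `𝔽̄₃` with the discrete topology
  letI : TopologicalSpace (AlgebraicClosure (ZMod 3)) := ⊥
  haveI : DiscreteTopology (AlgebraicClosure (ZMod 3)) := ⟨rfl⟩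
  set j : ZMod 3 →+* AlgebraicClosure (ZMod 3) := algebraMap (ZMod 3) (AlgebraicClosure (ZMod 3))
    with hj
  set ρ' : ModPGaloisRep ℚ (AlgebraicClosure (ZMod 3)) 2 :=
    FramedRep.baseChange j continuous_of_discreteTopology ρ with hρ'
  have hirr : ρ'.toGaloisRep.IsIrreducible := by
    rw [← ModPGaloisRep.isIrreducible_iff_toGaloisRep]
    exact habs.isIrreducible_baseChange (AlgebraicClosure (ZMod 3)) j _
  have hodd' : FramedGaloisRep.IsOdd ρ' := hodd.baseChange j _
  obtain ⟨N, hN, w, f, ι, hnew, hgal⟩ := hSerre (AlgebraicClosure (ZMod 3)) ρ' hirr hodd'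
  -- the weight is positive: a newform is non-zero, and `S_w(Γ₁(N)) = 0` for `w ≤ 0`
  have hw : (1 : ℤ) ≤ (w : ℤ) := by
    rcases Nat.eq_zero_or_pos w with h0 | hpos
    · subst h0
      exact absurd (cuspForm_eq_zero_of_weight_nonpos (le_of_eq (by simp)) f) hnew.2.2.2.ne_zero
    · exact_mod_cast hpos
  refine ⟨N, hN, (w : ℤ), f, AlgebraicClosure (ZMod 3), inferInstance, ⊥, ⟨rfl⟩, j, ι, hw, hnew,
    ?_⟩
  rw [ZMod.ringChar_zmod_n]
  exact hgal

/-- **Plan C closer (PROVED)**: the stub from lang.S37 at `p = 3` alone. -/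
theorem stub_modThree_of_serre3
    (hSerre : ∀ (k : Type) [Field k] [TopologicalSpace k] [DiscreteTopology k],
      exists_newform_of_odd_irreducible (p := 3) (k := k)) :
    StubModThree :=
  fun W _ ρ hρ habs ↦ isModular_of_serre3 hSerre ρ habs (isOdd_of_isTorsionGaloisRep_three W ρ hρ)

end Summit.ABC.ABC.Cruxes.FreyModularity.Sketch.StubModThreeIdeasK1G2
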